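import Mathlib.CategoryTheory.Monoidal.Grp
import HarnessLib

/-!
# Transport of a group structure along a monoidal functor injective on maps, given lifts of the structure maps

Topic: `Literature/AlgebraicGeometry/Limits` (category-theoretic core of the descent of group
laws through a limit of schemes, `Limits/LocalizationGroupSpread`). Let `F : C ⥤ D` be a monoidal
functor between cartesian monoidal categories, `N` an object of `C` with a group structure on
`F N`, and `P` a class of objects of `C` containing `𝟙_ C` and `N` and stable under `⊗`, such that
`F` is *injective* on morphisms `X ⟶ N` for `X` in `P`. If the three structure morphisms of
`F N` lift — there are `one : 𝟙_ C ⟶ N`, `mul : N ⊗ N ⟶ N`, `inv : N ⟶ N` whose images are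
`η_F ≫ η`, `δ_F ≫ μ`, `ι` — then these lifts form a group structure on `N` (`LiftedGrpData.grpObj`):
the axioms hold after applying `F`, hence before. Moreover an isomorphism `e : F N ≅ E` of `F N`
with a group object `E` defining the structure on `F N` (`GrpObj.ofIso e.symm`) becomes an
isomorphism of group objects for the structure induced by `F` from the lifted one
(`LiftedGrpData.isMonHom_hom`).

This is the variant of `Literature.NumberTheory.EllipticCurves.MapBijectiveInto.grpObj`
(`NumberTheory/EllipticCurves/NeronModelGroupStructure`, transport along a functor *bijective* on
maps into `N` — the Néron mapping property) in which surjectivity is only assumed for the three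
structure maps: the situation of EGA IV₃ 8.8.2 / Stacks 01ZC, where morphisms over the limit
`Spec A_S` come from *some* finite stage `Spec A[1/s]` while injectivity holds at a fixed stage
(for flat sources and separated targets). Mathlib's `Functor.FullyFaithful.grpObj` is the fully
faithful case.

## References

* A. Grothendieck, EGA IV₃, Thm. 8.8.2 (Publ. Math. IHÉS 28, 1966). [EGAIV3]
* The Stacks project, Tag 01ZC. [StacksProject]
* S. Bosch, W. Lütkebohmert, M. Raynaud, *Néron Models*, Springer 1990, Prop. 1.2/6 (the
  analogous transport for the Néron mapping property). [BLRNeronModels1990]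
-/

universe v₁ v₂ u₁ u₂

namespace Literature.AlgebraicGeometry.Limits

open CategoryTheory MonoidalCategory MonObj CartesianMonoidalCategory
open Functor.LaxMonoidal Functor.OplaxMonoidal
open scoped CategoryTheory.Obj

variable {C : Type u₁} [Category.{v₁} C] [CartesianMonoidalCategory C]
  {D : Type u₂} [Category.{v₂} D] [CartesianMonoidalCategory D]

section Structure

variable (F : C ⥤ D) [F.Monoidal] (N : C) [GrpObj (F.obj N)] (P : C → Prop)

/-- `LiftedGrpData F N P`: `F` is injective on morphisms `X ⟶ N` for `X` in the `⊗`-stable class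
`P ∋ 𝟙_ C, N`, and the unit, multiplication and inverse of the group object `F N` lift along `F`
to morphisms `one : 𝟙_ C ⟶ N`, `mul : N ⊗ N ⟶ N`, `inv : N ⟶ N` (up to the coherence morphisms
`η_F : F 𝟙 ⟶ 𝟙`, `δ_F : F (N ⊗ N) ⟶ F N ⊗ F N` of the monoidal functor `F`).
[cite: EGAIV3, Thm. 8.8.2 (the setting: structure maps spread out to a finite stage)] -/
structure LiftedGrpData where
  /-- `f ↦ F f` is injective on `Hom(X, N)` for `X` in `P`. -/
  injective : ∀ X, P X → Function.Injective fun f : X ⟶ N => F.map f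
  /-- `P` is stable under tensor products. -/
  tensor : ∀ X Y, P X → P Y → P (X ⊗ Y)
  /-- The unit object is in `P`. -/
  unit : P (𝟙_ C)
  /-- `N` is in `P`. -/
  self : P N
  /-- The lift of the unit. -/
  one : 𝟙_ C ⟶ N
  /-- The lift of the multiplication. -/
  mul : N ⊗ N ⟶ N
  /-- The lift of the inverse. -/
  inv : N ⟶ N
  /-- `F one` is the unit of `F N` (composed with `η_F : F 𝟙 ⟶ 𝟙`). -/
  map_one : F.map one = Functor.OplaxMonoidal.η F ≫ η[F.obj N]
  /-- `F mul` is the multiplication of `F N` (composed with `δ_F : F (N ⊗ N) ⟶ F N ⊗ F N`). -/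
  map_mul : F.map mul = Functor.OplaxMonoidal.δ F N N ≫ μ[F.obj N]
  /-- `F inv` is the inverse of `F N`. -/
  map_inv : F.map inv = ι[F.obj N]

variable {F N P}

namespace LiftedGrpData

/-- `F` is injective on morphisms from a `P`-object to `N`. [folklore] -/
theorem map_injective (h : LiftedGrpData F N P) {X : C} (hX : P X) {f g : X ⟶ N} (hfg : F.map f = F.map g) : f = g :=
  h.injective X hX hfg

/-- **The lifted unit and multiplication form a monoid structure on `N`**: each axiom is an
equality of morphisms `X ⟶ N` with `X ∈ {𝟙 ⊗ N, N ⊗ 𝟙, (N ⊗ N) ⊗ N}` in `P`, and holds after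
applying `F`, where it becomes the corresponding axiom of `F N` (as in Mathlib's
`Functor.FullyFaithful.monObj`). [cite: EGAIV3, Thm. 8.8.2 (i) (uniqueness at a finite stage)] -/
@[simps]
abbrev monObj (h : LiftedGrpData F N P) : MonObj N where
  one := h.one
  mul := h.mul
  one_mul := h.map_injective (h.tensor _ _ h.unit h.self) <| by
    simp [h.map_one, h.map_mul, ← δ_natural_left_assoc]
  mul_one := h.map_injective (h.tensor _ _ h.self h.unit) <| by
    simp [h.map_one, h.map_mul, ← δ_natural_right_assoc]
  mul_assoc := h.map_injective (h.tensor _ _ (h.tensor _ _ h.self h.self) h.self) <| by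
    simp [h.map_mul, ← δ_natural_left_assoc, ← δ_natural_right_assoc]

/-- **The lifted structure maps form a group structure on `N`** (inverse axioms transferred the
same way). [cite: EGAIV3, Thm. 8.8.2 (i) (uniqueness at a finite stage)] -/
@[simps]
abbrev grpObj (h : LiftedGrpData F N P) : GrpObj N where
  __ := h.monObj
  inv := h.inv
  left_inv := h.map_injective h.self <| by
    simp [h.map_one, h.map_mul, h.map_inv, Functor.OplaxMonoidal.η_of_cartesianMonoidalCategory]
  right_inv := h.map_injective h.self <| by
    simp [h.map_one, h.map_mul, h.map_inv, Functor.OplaxMonoidal.η_of_cartesianMonoidalCategory]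

end LiftedGrpData

end Structure

section Iso

variable {F : C ⥤ D} [F.Monoidal] {N : C} {P : C → Prop}

/-- If the group structure on `F N` is the one transported along an isomorphism `e : F N ≅ E`
from a group object `E` (`GrpObj.ofIso e.symm`), then for the structure induced by `F` from the
lifted group structure on `N`, `e` is an isomorphism of group objects: the induced unit and
multiplication are `ε_F ≫ F one = η` and `μ_F ≫ F mul = μ` (`ε ≫ η_F = 𝟙`, `μ_F ≫ δ_F = 𝟙`). [folklore] -/
theorem LiftedGrpData.isMonHom_hom {E : D} [GrpObj E] (e : F.obj N ≅ E)
    (h : @LiftedGrpData C _ _ D _ _ F _ N (GrpObj.ofIso e.symm) P) :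
    letI : GrpObj (F.obj N) := GrpObj.ofIso e.symm
    letI : GrpObj N := h.grpObj
    @IsMonHom D _ _ (F.obj N) E (Functor.monObjObj (F := F) N) inferInstance e.hom := by
  letI : GrpObj (F.obj N) := GrpObj.ofIso e.symm
  letI : GrpObj N := h.grpObj
  refine { one_hom := ?_, mul_hom := ?_ }
  · simp only [Functor.obj.η_def, LiftedGrpData.monObj_one, h.map_one, Category.assoc,
      Functor.Monoidal.ε_η_assoc, MonObj.ofIso_one, Iso.symm_hom, Iso.inv_hom_id,
      Category.comp_id]
  · simp only [Functor.obj.μ_def, LiftedGrpData.monObj_mul, h.map_mul, Category.assoc,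
      Functor.Monoidal.μ_δ_assoc, MonObj.ofIso_mul, Iso.symm_hom, Iso.symm_inv, Iso.inv_hom_id,
      Category.comp_id]

end Iso

end Literature.AlgebraicGeometry.Limits
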